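import Mathlib.Analysis.Calculus.Deriv.MeanValue
import Mathlib.Analysis.SpecialFunctions.ExpDeriv
import HarnessLib

/-!
# Negative side of K2Q `QuasiStaticSolenoidalCellTensorQ` (stmt-AnomalousDissipation-19072): the window floor lemma
# (abstract principal/rest energy system; helper, `--supports stmt-AnomalousDissipation-19072`)

Summits-side helper file (everything proved; no definitions, no named facts).  Route `SolenoidalFractalHomogenisation`,
item K2Q asks for SOME isotropic lattice word realising EVERY gain below its NOMINAL Taylor constant `c₀`; the cell's
finding F12 and the landed negative lemma `…Negative.not_forall_isotropic_nominalGain` say the realised constant of a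
ramped word is `(1 - 4ρ/3)c₀ < c₀`.  Refuting the `∃ W` statement needs an energy FLOOR for the passive solenoidal vector
around the cells of an ARBITRARY word (the tree's `upperSome` covers pre-stretched cubature words only, through a
slot-by-slot ladder analysis that needs long slots).  This file is the slot-length-free core of such a floor, as a lemma
about real functions on a window `[t₀, t₁]`:

the PRINCIPAL energy `x` and the REST energy `R` of a Galerkin truncation obey `x' = -λx + τ`, `R' = -D - τ` with the
rest dissipation `D ≥ ΛR` (spectral gap of the rest) and an exchange term `τ` controlled by AM–GM against the rest
dissipation, `|τ| ≤ 2ψ + D/2` (`ψ` = the Taylor drain density of the active layer).  Then (`window_floor`)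
* the total energy `x + R` is non-increasing;
* `x(t) ≥ x(t₀) - R(t₀) - λ(x(t₀)+R(t₀))(t-t₀) - 4Φ(t)`, `Φ = ∫_{t₀}^t ψ` — the principal energy cannot be drained
  faster than FOUR times the drain density allows (the sharp Taylor factor: at the steady corrector the bound is
  attained), whatever the time dependence of the carrier inside the window: the function
  `x - R + λ(x₀+R₀)(t-t₀) + 4Φ` is non-decreasing;
* `R(t) ≤ R(t₀)e^{-Λ(t-t₀)/2} + 4Ψ/Λ` when `ψ ≤ Ψ` — the rest relaxes to the slaved level at half the gap rate.
Chained over windows of many periods (cone `R ≤ ηx` inherited) this gives the exponential floor with the realised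
constant; that, the Galerkin identification and the isotropy bookkeeping are the objects of the sequel files.
This is NOT a proof of anomalous dissipation, and by itself not of `¬ QuasiStaticSolenoidalCellTensorQ`.
-/

set_option linter.dupNamespace false

noncomputable section

namespace Summit.AnomalousDissipation.AnomalousDissipation.Theorems.QuasiStaticSolenoidalCellTensorQ.Negative

open Set

/-- Monotonicity on a closed window from a derivative given WITHIN the window at every point of it (the form in which
the Galerkin mode equations are available): non-positive derivative ⇒ antitone. -/
theorem antitoneOn_Icc_of_hasDerivWithinAt {t₀ t₁ : ℝ} {F F' : ℝ → ℝ}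
    (hF : ∀ t ∈ Icc t₀ t₁, HasDerivWithinAt F (F' t) (Icc t₀ t₁) t) (hF' : ∀ t ∈ Ioo t₀ t₁, F' t ≤ 0) :
    AntitoneOn F (Icc t₀ t₁) := by
  refine antitoneOn_of_hasDerivWithinAt_nonpos (convex_Icc t₀ t₁) (f' := F')
    (fun t ht => (hF t ht).continuousWithinAt) (fun t ht => ?_) (fun t ht => ?_)
  · exact (hF t (interior_subset ht)).mono interior_subset
  · rw [interior_Icc] at ht
    exact hF' t ht

/-- Monotonicity on a closed window from a derivative given WITHIN the window at every point of it: non-negative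
derivative ⇒ monotone. -/
theorem monotoneOn_Icc_of_hasDerivWithinAt {t₀ t₁ : ℝ} {F F' : ℝ → ℝ}
    (hF : ∀ t ∈ Icc t₀ t₁, HasDerivWithinAt F (F' t) (Icc t₀ t₁) t) (hF' : ∀ t ∈ Ioo t₀ t₁, 0 ≤ F' t) :
    MonotoneOn F (Icc t₀ t₁) := by
  refine monotoneOn_of_hasDerivWithinAt_nonneg (convex_Icc t₀ t₁) (f' := F')
    (fun t ht => (hF t ht).continuousWithinAt) (fun t ht => ?_) (fun t ht => ?_)
  · exact (hF t (interior_subset ht)).mono interior_subset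
  · rw [interior_Icc] at ht
    exact hF' t ht

/-- **The window floor lemma.**  On a window `[t₀, t₁]` let `x, R ≥ 0` (principal and rest energies) satisfy
`x' = -λx + τ`, `R' = -D - τ` with `λ ≥ 0`, rest gap `ΛR ≤ D` (`Λ > 0`), and the AM–GM exchange bound
`|τ| ≤ 2ψ + D/2` with `ψ ≤ Ψ`, `0 ≤ Ψ`; let `Φ' = ψ`, `Φ(t₀) = 0`.  Then for every `t` in the window:
(i) `x(t) + R(t) ≤ x(t₀) + R(t₀)`; (ii) `x(t₀) - R(t₀) - λ(x(t₀)+R(t₀))(t-t₀) - 4Φ(t) ≤ x(t)`;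
(iii) `R(t) ≤ R(t₀)·exp(-(Λ/2)(t-t₀)) + 4Ψ/Λ`. -/
theorem window_floor {t₀ t₁ : ℝ} (x R D τ ψ Φ : ℝ → ℝ) (lam Λ Ψ : ℝ)
    (hx : ∀ t ∈ Icc t₀ t₁, HasDerivWithinAt x (-(lam * x t) + τ t) (Icc t₀ t₁) t)
    (hR : ∀ t ∈ Icc t₀ t₁, HasDerivWithinAt R (-(D t) - τ t) (Icc t₀ t₁) t)
    (hΦ : ∀ t ∈ Icc t₀ t₁, HasDerivWithinAt Φ (ψ t) (Icc t₀ t₁) t) (hΦ0 : Φ t₀ = 0)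
    (hx0 : ∀ t ∈ Icc t₀ t₁, 0 ≤ x t) (hR0 : ∀ t ∈ Icc t₀ t₁, 0 ≤ R t) (hlam : 0 ≤ lam) (hΛ : 0 < Λ) (hΨ : 0 ≤ Ψ)
    (hψ : ∀ t ∈ Icc t₀ t₁, ψ t ≤ Ψ) (hD : ∀ t ∈ Icc t₀ t₁, Λ * R t ≤ D t)
    (hτ : ∀ t ∈ Icc t₀ t₁, |τ t| ≤ 2 * ψ t + D t / 2) :
    (∀ t ∈ Icc t₀ t₁, x t + R t ≤ x t₀ + R t₀) ∧
    (∀ t ∈ Icc t₀ t₁, x t₀ - R t₀ - lam * (x t₀ + R t₀) * (t - t₀) - 4 * Φ t ≤ x t) ∧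
    (∀ t ∈ Icc t₀ t₁, R t ≤ R t₀ * Real.exp (-(Λ / 2) * (t - t₀)) + 4 * Ψ / Λ) := by
  have hD0 : ∀ t ∈ Icc t₀ t₁, 0 ≤ D t := fun t ht =>
    le_trans (mul_nonneg hΛ.le (hR0 t ht)) (hD t ht)
  -- (i) the total energy is non-increasing
  have hE : ∀ t ∈ Icc t₀ t₁, HasDerivWithinAt (fun s => x s + R s) (-(lam * x t) - D t) (Icc t₀ t₁) t := by
    intro t ht
    refine ((hx t ht).add (hR t ht)).congr_deriv ?_
    ring
  have hEanti : AntitoneOn (fun s => x s + R s) (Icc t₀ t₁) :=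
    antitoneOn_Icc_of_hasDerivWithinAt hE fun t ht => by
      have ht' := Ioo_subset_Icc_self ht
      nlinarith [hx0 t ht', hD0 t ht', hlam]
  have h1 : ∀ t ∈ Icc t₀ t₁, x t + R t ≤ x t₀ + R t₀ := by
    intro t ht
    have ht₀ : t₀ ∈ Icc t₀ t₁ := ⟨le_rfl, ht.1.trans ht.2⟩
    exact hEanti ht₀ ht ht.1
  refine ⟨h1, ?_, ?_⟩
  · -- (ii) the drain functional `G = x - R + λ(x₀+R₀)(t-t₀) + 4Φ` is non-decreasing
    have hG : ∀ t ∈ Icc t₀ t₁, HasDerivWithinAt (fun s => x s - R s + lam * (x t₀ + R t₀) * (s - t₀) + 4 * Φ s)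
        (lam * (x t₀ + R t₀ - x t) + 2 * τ t + D t + 4 * ψ t) (Icc t₀ t₁) t := by
      intro t ht
      have hl : HasDerivWithinAt (fun s => lam * (x t₀ + R t₀) * (s - t₀)) (lam * (x t₀ + R t₀)) (Icc t₀ t₁) t := by
        have h := ((hasDerivWithinAt_id t (Icc t₀ t₁)).sub_const t₀).const_mul (lam * (x t₀ + R t₀))
        refine h.congr_deriv ?_
        simp
      refine ((((hx t ht).sub (hR t ht)).add hl).add ((hΦ t ht).const_mul 4)).congr_deriv ?_
      ring
    have hGmono : MonotoneOn (fun s => x s - R s + lam * (x t₀ + R t₀) * (s - t₀) + 4 * Φ s) (Icc t₀ t₁) :=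
      monotoneOn_Icc_of_hasDerivWithinAt hG fun t ht => by
        have ht' := Ioo_subset_Icc_self ht
        have hxle : x t ≤ x t₀ + R t₀ := by linarith [h1 t ht', hR0 t ht']
        have habs := hτ t ht'
        have hτlow : -(2 * ψ t + D t / 2) ≤ τ t := by
          have := neg_abs_le (τ t)
          linarith
        nlinarith [mul_nonneg hlam (sub_nonneg.2 hxle)]
    intro t ht
    have ht₀ : t₀ ∈ Icc t₀ t₁ := ⟨le_rfl, ht.1.trans ht.2⟩
    have hmono := hGmono ht₀ ht ht.1
    simp only [sub_self, mul_zero, add_zero, hΦ0] at hmono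
    linarith [hR0 t ht]
  · -- (iii) relaxation of the rest: `H = (R - 4Ψ/Λ)·exp((Λ/2)(t-t₀))` is non-increasing
    have hH : ∀ t ∈ Icc t₀ t₁, HasDerivWithinAt (fun s => (R s - 4 * Ψ / Λ) * Real.exp (Λ / 2 * (s - t₀)))
        ((-(D t) - τ t) * Real.exp (Λ / 2 * (t - t₀)) +
          (R t - 4 * Ψ / Λ) * (Real.exp (Λ / 2 * (t - t₀)) * (Λ / 2))) (Icc t₀ t₁) t := by
      intro t ht
      have he : HasDerivWithinAt (fun s => Real.exp (Λ / 2 * (s - t₀))) (Real.exp (Λ / 2 * (t - t₀)) * (Λ / 2))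
          (Icc t₀ t₁) t := by
        have h1' := ((hasDerivWithinAt_id t (Icc t₀ t₁)).sub_const t₀).const_mul (Λ / 2)
        have h2 := h1'.exp
        refine h2.congr_deriv ?_
        simp
      exact ((hR t ht).sub_const (4 * Ψ / Λ)).mul he
    have hHanti : AntitoneOn (fun s => (R s - 4 * Ψ / Λ) * Real.exp (Λ / 2 * (s - t₀))) (Icc t₀ t₁) :=
      antitoneOn_Icc_of_hasDerivWithinAt hH fun t ht => by
        have ht' := Ioo_subset_Icc_self ht
        have hpos := Real.exp_pos (Λ / 2 * (t - t₀))
        have habs := hτ t ht'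
        have hτup : -(τ t) ≤ 2 * ψ t + D t / 2 := by
          have := neg_le_abs (τ t)
          linarith
        have hkey : (-(D t) - τ t) + (R t - 4 * Ψ / Λ) * (Λ / 2) ≤ 0 := by
          have e : (R t - 4 * Ψ / Λ) * (Λ / 2) = Λ * R t / 2 - 2 * Ψ := by field_simp; ring
          rw [e]
          linarith [hD t ht', hψ t ht']
        have e2 : (-(D t) - τ t) * Real.exp (Λ / 2 * (t - t₀)) +
            (R t - 4 * Ψ / Λ) * (Real.exp (Λ / 2 * (t - t₀)) * (Λ / 2)) =
            ((-(D t) - τ t) + (R t - 4 * Ψ / Λ) * (Λ / 2)) * Real.exp (Λ / 2 * (t - t₀)) := by ring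
        rw [e2]
        exact mul_nonpos_of_nonpos_of_nonneg hkey hpos.le
    intro t ht
    have ht₀ : t₀ ∈ Icc t₀ t₁ := ⟨le_rfl, ht.1.trans ht.2⟩
    have hmono := hHanti ht₀ ht ht.1
    simp only [sub_self, mul_zero, Real.exp_zero, mul_one] at hmono
    -- `(R t - 4Ψ/Λ) e^{(Λ/2)(t-t₀)} ≤ R t₀ - 4Ψ/Λ ≤ R t₀`
    have hpos := Real.exp_pos (Λ / 2 * (t - t₀))
    have hq : R t - 4 * Ψ / Λ ≤ R t₀ * Real.exp (-(Λ / 2) * (t - t₀)) := by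
      have h3 : (R t - 4 * Ψ / Λ) * Real.exp (Λ / 2 * (t - t₀)) ≤ R t₀ := by
        have : 0 ≤ 4 * Ψ / Λ := by positivity
        linarith
      have h4 := mul_le_mul_of_nonneg_right h3 (Real.exp_pos (-(Λ / 2) * (t - t₀))).le
      rwa [mul_assoc, ← Real.exp_add, show Λ / 2 * (t - t₀) + -(Λ / 2) * (t - t₀) = 0 by ring, Real.exp_zero,
        mul_one] at h4
    linarith

end Summit.AnomalousDissipation.AnomalousDissipation.Theorems.QuasiStaticSolenoidalCellTensorQ.Negative

end
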